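import Mathlib.RingTheory.Artinian.Module
import HarnessLib

/-!
# The ordinary part `⋂ₙ range Uⁿ` of a finite module: `U` acts bijectively (Fitting's lemma)

Topic `NumberTheory/Automorphic`; namespace `Literature.NumberTheory.Automorphic`; theorems only.
The finiteness input of Hida's lemma and of independence of weight
([KhareThorne2017, §6.4, Lemma 6.10 and Prop. 6.13]; [Hida1994AIF, §2]) in the form the tree's
statements use it: for an endomorphism `U` of a FINITE module `M` (e.g. `H^i(X_{U(c,c)}, 𝒪/ϖ^r)`),
the "ordinary part" `M^ord = ⋂ₙ range Uⁿ` (the image of Hida's idempotent `e = lim U^{n!}`) is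
`range U^N` for `N ≫ 0` (Mathlib's Fitting lemma `LinearMap.eventually_iInf_range_pow_eq` for
Artinian modules) and **`U` restricts to a bijection of `M^ord`** (`bijOn_iInf_range_pow`), i.e.
`U` is injective on `M^ord` (`injOn_iInf_range_pow`) and maps it onto itself
(`surjOn_iInf_range_pow`).  These are exactly the hypotheses `hinj`/`hsurj` of the abstract Hida
lemma `bijOn_of_comp_eq` (`ArithmeticQuotientHeckeTwoLevel`), of `bijOn_cohomologyPullback_levelAt`
(`HidaLemmaGL2`) and of `bijOn_pushforwardCohomology` (`LevelActionCoefficientChange`).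
Proof file supporting the named fact `hidaControl_dominantOrdinaryPoint`.

## References

* C. Khare, J. A. Thorne, *Potential automorphy and the Leopoldt conjecture*, Amer. J. Math. 139
  (2017), §6.4 (arXiv:1409.7007, held). [KhareThorne2017]
* H. Hida, *p-adic ordinary Hecke algebras for GL(2)*, Ann. Inst. Fourier 44 (1994), §2 (held).
  [Hida1994AIF]
-/

namespace Literature.NumberTheory.Automorphic

variable {R M : Type*} [Ring R] [AddCommGroup M] [Module R M]

/-- `U` maps `⋂ₙ range Uⁿ` into itself (any module). [folklore] -/
theorem mapsTo_iInf_range_pow_self (U : Module.End R M) :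
    Set.MapsTo U (⨅ n : ℕ, LinearMap.range (U ^ n) : Submodule R M)
      (⨅ n : ℕ, LinearMap.range (U ^ n) : Submodule R M) := by
  intro x hx
  simp only [SetLike.mem_coe, Submodule.mem_iInf, LinearMap.mem_range] at hx ⊢
  intro n
  obtain ⟨y, rfl⟩ := hx n
  exact ⟨U y, by rw [← Module.End.mul_apply, ← pow_succ, pow_succ', Module.End.mul_apply]⟩

/-- **`U` maps the ordinary part `⋂ₙ range Uⁿ` of a finite module ONTO itself** (Fitting:
`⋂ₙ range Uⁿ = range U^N = range U^{N+1}` for `N ≫ 0`). [cite: KhareThorne2017, §6.4, proof of Lemma 6.10] -/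
theorem surjOn_iInf_range_pow [Finite M] (U : Module.End R M) :
    Set.SurjOn U (⨅ n : ℕ, LinearMap.range (U ^ n) : Submodule R M)
      (⨅ n : ℕ, LinearMap.range (U ^ n) : Submodule R M) := by
  haveI : IsArtinian R M := isArtinian_of_finite
  obtain ⟨N, hN⟩ := Filter.eventually_atTop.1 U.eventually_iInf_range_pow_eq
  intro x hx
  rw [SetLike.mem_coe, hN (N + 1) (Nat.le_succ N), LinearMap.mem_range] at hx
  obtain ⟨y, rfl⟩ := hx
  refine ⟨(U ^ N) y, ?_, by rw [← Module.End.mul_apply, ← pow_succ']⟩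
  rw [SetLike.mem_coe, hN N le_rfl]
  exact LinearMap.mem_range_self _ _

/-- **`U` is injective on the ordinary part `⋂ₙ range Uⁿ` of a finite module** (a surjective
self-map of a finite set is injective). [cite: KhareThorne2017, §6.4, proof of Lemma 6.10] -/
theorem injOn_iInf_range_pow [Finite M] (U : Module.End R M) :
    Set.InjOn U (⨅ n : ℕ, LinearMap.range (U ^ n) : Submodule R M) := by
  have hs := surjOn_iInf_range_pow U
  have hm := mapsTo_iInf_range_pow_self U
  haveI : Finite ((⨅ n : ℕ, LinearMap.range (U ^ n) : Submodule R M) : Set M) :=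
    Subtype.finite
  have hsurj : Function.Surjective (hm.restrict _ _ _) := (Set.MapsTo.restrict_surjective_iff hm).2 hs
  have hinj : Function.Injective (hm.restrict _ _ _) := Finite.injective_iff_surjective.2 hsurj
  exact (Set.MapsTo.restrict_inj hm).1 hinj

/-- **Fitting: `U` acts bijectively on the ordinary part `⋂ₙ range Uⁿ` of a finite module.**
[cite: KhareThorne2017, §6.4] [cite: Hida1994AIF, §2] -/
theorem bijOn_iInf_range_pow [Finite M] (U : Module.End R M) :
    Set.BijOn U (⨅ n : ℕ, LinearMap.range (U ^ n) : Submodule R M)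
      (⨅ n : ℕ, LinearMap.range (U ^ n) : Submodule R M) :=
  ⟨mapsTo_iInf_range_pow_self U, injOn_iInf_range_pow U, surjOn_iInf_range_pow U⟩

/-- The ordinary part of a finite module is `range U^N` for all large `N`. [folklore] -/
theorem exists_iInf_range_pow_eq [Finite M] (U : Module.End R M) :
    ∃ N : ℕ, ∀ n, N ≤ n → (⨅ m : ℕ, LinearMap.range (U ^ m)) = LinearMap.range (U ^ n) := by
  haveI : IsArtinian R M := isArtinian_of_finite
  exact Filter.eventually_atTop.1 U.eventually_iInf_range_pow_eq

end Literature.NumberTheory.Automorphic
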